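import Summits.Langlands.Langlands.Theses.PrimitiveRankLadder

/-!
# Glue of the layer-2 split of `SatakeAvatarExistence` (route PrimitiveRankLadder)

Closes the glue item of `route-Langlands-PrimitiveRankLadder` generated by
`--split SatakeAvatarExistence --glue-decl-name SatakeAvatarExistence_of_split`:
`SatakeAvatarExistence_of_split :
  SpreadInducedAvatar → InducedAvatarDescent → RestrictionTwistTransport → InductionTransport →
    CollidingPrimitiveAvatars → CuspidalAvatarIrreducible → SatakeAvatarExistence`.
Pure logic.  ONE excluded middle on «the datum `π.1` lies in the regular-induction hull» (the impredicative least class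
inlined in `CollidingPrimitiveAvatars`).  Off the hull, REST♯ is W⁺ verbatim.  On the hull, instantiate the leastness at the
class «cuspidal L-algebraic data of positive rank having a SEMISIMPLE Satake–Frobenius avatar for every (ℓ, ι)»: it contains
rung 0 (SPRAI hands the automorphic induction `P` over the TR/CM base together with its semisimple avatar `R`, at the compact
level `isCompact_glFiniteIntegralLevel_holds`; EXT descends it to `π`), it is closed under the (up) clause by RTT and under the
(ai) clause by AIT (the two print transports, = RootDecomp1 items 29150 / 29151 verbatim); hence `π` has a semisimple avatar,
which IRR makes irreducible.  This is the lens-1-g9 node proof `InducedRegularityLadder.satakeAvatarExistence_of_split`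
(decomp-langlands, 2026-08-30, v2 after critic row 105; certified against the gate render of the split in kit_check.lean and
fullrender_probe.lean, rc 0), transported to the tree's declarations.  No definitions, no new mathematics.
-/

set_option linter.dupNamespace false -- project-wide option; `Summit.Langlands.Langlands` is the mandated namespace

namespace Summit.Langlands.Langlands.Theorems

open scoped Classical
open Filter

/-- The glue item of the split of `PrimitiveRankLadder.SatakeAvatarExistence` (stmt-Langlands-17415): the hull pieces SPRAI
(induce to the TR/CM base and realise there), EXT (descend the avatar), RTT / AIT (print transports saturating the hull),
IRR (irreducibility) and the off-hull residual REST♯ imply W⁺.  Proof: `by_cases` on hull membership + leastness. -/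
theorem SatakeAvatarExistence_of_split_proof :
    Summit.Langlands.Langlands.Theses.PrimitiveRankLadder.SatakeAvatarExistence_of_split := by
  intro hS hD hR hA hC hI K _ _ n hcpt hn π hL ℓ _ ι
  by_cases hh : ∀ S : (∀ (K : Type) [Field K] [NumberField K] (n : ℕ) (hcpt : Literature.NumberTheory.Automorphic.isCompact_glFiniteIntegralLevel n K), Literature.NumberTheory.Automorphic.AutomorphicRepData (Literature.NumberTheory.Automorphic.AutomorphyDatum.gl n K hcpt) → Prop), ((∀ (K : Type) [Field K] [NumberField K] (n : ℕ) (hcpt : Literature.NumberTheory.Automorphic.isCompact_glFiniteIntegralLevel n K) (π : Literature.NumberTheory.Automorphic.CuspidalAutomorphicRepData n K hcpt), 0 < n → π.1.IsLAlgebraic → (∃ (K₀ : Type) (_ : Field K₀) (_ : NumberField K₀) (_ : Algebra K₀ K), IsGalois K₀ K ∧ IsCyclic (K ≃ₐ[K₀] K) ∧ (NumberField.IsTotallyReal K₀ ∨ NumberField.IsCMField K₀) ∧ ∃ T : Literature.NumberTheory.Automorphic.InfinityType K n, π.1.HasInfinityType T ∧ (Literature.NumberTheory.Automorphic.InfinityType.automorphicInduction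 K₀ (n * Module.finrank K₀ K) T).IsRegular) → S K n hcpt π.1) ∧ (∀ (K₀ : Type) [Field K₀] [NumberField K₀] (M : Type) [Field M] [NumberField M] [Algebra K₀ M] (n : ℕ) (h₀ : Literature.NumberTheory.Automorphic.isCompact_glFiniteIntegralLevel n K₀) (hM : Literature.NumberTheory.Automorphic.isCompact_glFiniteIntegralLevel n M) (h₁ : Literature.NumberTheory.Automorphic.isCompact_glFiniteIntegralLevel 1 M) (π₀ : Literature.NumberTheory.Automorphic.CuspidalAutomorphicRepData n K₀ h₀) (χ : Literature.NumberTheory.Automorphic.AutomorphicRepData (Literature.NumberTheory.Automorphic.AutomorphyDatum.gl 1 M h₁)) (P : Literature.NumberTheory.Automorphic.AutomorphicRepData (Literature.NumberTheory.Automorphic.AutomorphyDatum.gl n M hM)), π₀.1.IsLAlgebraic → χ.IsLAlgebraic → (∀ᶠ w : IsDedekindDomain.HeightOneSpectrum (NumberField.RingOfIntegers M) in cofinite, ∀ (u : IsDedekindDomain.HeightOneSpectrum (NumberField.RingOfIntegers K₀)) (α : Multiset ℂ) (c : ℂ), w.asIdeal.under (NumberField.RingOfIntegers K₀) = u.asIdeal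 → π₀.1.HasSatakeParamAt u α → χ.HasSatakeParamAt w {c} → P.HasSatakeParamAt w ((α.map (· ^ w.asIdeal.inertiaDeg (NumberField.RingOfIntegers K₀))).map (c * ·))) → S K₀ n h₀ π₀.1 → S M n hM P) ∧ (∀ (K : Type) [Field K] [NumberField K] (L : Type) [Field L] [NumberField L] [Algebra K L] (m n : ℕ) (hL : Literature.NumberTheory.Automorphic.isCompact_glFiniteIntegralLevel m L) (hcpt : Literature.NumberTheory.Automorphic.isCompact_glFiniteIntegralLevel n K) (σ : Literature.NumberTheory.Automorphic.CuspidalAutomorphicRepData m L hL) (π : Literature.NumberTheory.Automorphic.AutomorphicRepData (Literature.NumberTheory.Automorphic.AutomorphyDatum.gl n K hcpt)), 0 < m → σ.1.IsLAlgebraic → (∀ᶠ v : IsDedekindDomain.HeightOneSpectrum (NumberField.RingOfIntegers K) in cofinite, ∀ β : IsDedekindDomain.HeightOneSpectrum (NumberField.RingOfIntegers L) → Multiset ℂ, (∀ w : IsDedekindDomain.HeightOneSpectrum (NumberField.RingOfIntegers L), w.asIdeal.under (NumberField.RingOfIntegers K) = v.asIdeal → σ.1.HasSatakeParamAt w (β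 w)) → ∃ α : Multiset ℂ, π.HasSatakeParamAt v α ∧ Literature.NumberTheory.Automorphic.satakePolynomial α = ∏ᶠ w ∈ {w : IsDedekindDomain.HeightOneSpectrum (NumberField.RingOfIntegers L) | w.asIdeal.under (NumberField.RingOfIntegers K) = v.asIdeal}, (Literature.NumberTheory.Automorphic.satakePolynomial (β w)).comp (Polynomial.X ^ w.asIdeal.inertiaDeg (NumberField.RingOfIntegers K))) → S L m hL σ.1 → S K n hcpt π)) → S K n hcpt π.1
  · -- π.1 is in the regular-induction hull: semisimple avatar by LEASTNESS of the hull, then IRR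
    have key := hh
      (fun K _ _ n hcpt P => 0 < n → P.W ≤ Literature.NumberTheory.Automorphic.cuspFormsGL n K hcpt → P.IsLAlgebraic → ∀ (ℓ : ℕ) [Fact ℓ.Prime] (ι : PadicAlgCl ℓ ≃+* ℂ), ∃ ρ : Literature.NumberTheory.GaloisRepresentations.FramedGaloisRep K (PadicAlgCl ℓ) n, ρ.toGaloisRep.IsSemisimple ∧ ∀ᶠ v : IsDedekindDomain.HeightOneSpectrum (NumberField.RingOfIntegers K) in Filter.cofinite, SatakeFrobCompatibleAt ι P ρ v)
      ⟨?_, ?_, ?_⟩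
    · obtain ⟨ρ, hss, hc⟩ := key hn π.2 hL ℓ ι
      exact ⟨ρ, hI K n hcpt hn π hL ℓ ι ρ hss hc, hc⟩
    · -- (r0) rung 0: induce to the TR/CM base and realise there (SPRAI), descend the avatar (EXT)
      intro K _ _ n hcpt π hn hL hd _ _ _ ℓ _ ι
      obtain ⟨K₀, _, _, _, hG, hcyc, hK₀, T, hT, hreg⟩ := hd
      obtain ⟨P, R, hAI, hRss, hRc⟩ := hS K n hcpt hn π hL K₀ hG hcyc hK₀ T hT hreg ℓ ι
        (Literature.NumberTheory.Automorphic.isCompact_glFiniteIntegralLevel_holds _ K₀)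
      exact hD K n hcpt hn π hL K₀ hG hcyc T hT hreg ℓ ι _ _ P R hAI hRss hRc
    · -- (up) a.e.-twisted weak base change up: RTT (= RootDecomp1 item 29150)
      intro K₀ _ _ M _ _ _ n h₀ hM h₁ π₀ χ P hL₀ hχ hrel hπ₀ hn hP hLP ℓ _ ι
      obtain ⟨ρ₀, h0ss, h0c⟩ := hπ₀ hn π₀.2 hL₀ ℓ ι
      exact hR K₀ M n h₀ hM h₁ hn π₀ χ ⟨P, hP⟩ hL₀ hχ hLP hrel ℓ ι ρ₀ h0ss h0c
    · -- (ai) automorphic induction down: AIT (= RootDecomp1 item 29151)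
      intro K _ _ L _ _ _ m n hL hcpt σ π hm hσ hrel hσS hn hπ hLπ ℓ _ ι
      obtain ⟨r, hrss, hrc⟩ := hσS hm σ.2 hσ ℓ ι
      exact hA K L m n hL hcpt hm hn σ ⟨π, hπ⟩ hσ hLπ hrel ℓ ι r hrss hrc
  · -- off the hull: REST♯ is W⁺ verbatim there
    exact hC K n hcpt hn π hL hh ℓ ι

end Summit.Langlands.Langlands.Theorems
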